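import Summits.ValiantsHypothesis.ValiantsHypothesis.Theorems.SymmetroidPencilBasics
import Summits.ValiantsHypothesis.ValiantsHypothesis.Theorems.LacunarySymmetroidMatrixDescartesStubReverse

/-!
# `WeakLifting`, line (B) `tower_graft` — calibration: the two-sided `2 × 2` word exceeds `2m` ON A GENUINE 2-TOWER

Crux `stmt-ValiantsHypothesis-19561` (`Theses.KPlusLogSqLaw.WeakLifting`), restricted sub-case of the line
`Cruxes/WeakLifting/Lines/tower_graft.lean` (tower supports `IsTower m d : ∀ l < l', m·d l < d l'`).  The V1 `Lift`
line (`Cruxes/MatrixDescartes/Lines/Lift.lean`) reduced `MatrixDescartes` to the two-sided word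
`X^e • J + ∑ₖ X^{dₖ} • Pₖ` (`Pₖ ⪰ 0` on both sides of the pivot `e`, one symmetric `J`) and killed every `K`-free rung
of it OFF towers: the rank-one rung (`…RankOneWitness`, support `(0,5,6,7,13)`), the definite rung (`…DefiniteWitness`,
`(0,6,7,8,15)`) and the (2,1)-configuration (`Lift` v14, `(0,2,3,5)`) all reach `Z₊ = 6 = 3m` at `m = 2` — every one
of them with exponents CLUSTERED around the pivot (consecutive ratios `< 2`), which no 2-tower admits.  Line (B)'s pen
asked (S5 memo rev 2h, price P1) whether the tower hypothesis rescues the `K`-free law `Z₊ ≤ 2m` for this word.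

This file certifies in the kernel that it does NOT, already with FOUR letters: on the 2-tower `(0, 1, 3, 7)`
(`2·0 < 1`, `2·1 < 3`, `2·3 < 7`) the pencil `T(X) = X¹ • J + X⁰ • P₀ + X³ • P₃ + X⁷ • P₇` with
`P₀ = v vᵀ`, `v = (43, −76)`, `P₃ = u uᵀ + u' u'ᵀ`, `u = (10, 60)`, `u' = (0, 15)` (positive definite),
`P₇ = z zᵀ`, `z = (−18, −38)` and the INDEFINITE pivot letter `J = [[−2268, 2154], [2154, −303]]` at the exponent `1`
(one PSD letter below the pivot, two above: the (1,2)-configuration) has `det T` alternating in sign at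
`1/8 < 1/4 < 1/2 < 7/8 < 1 < 3/2 < 3`, hence `Z₊ ≥ 6 > 4 = 2m` (`six_le_card_posRoots_T₂₄`,
`not_towerTwoSidedLaw_two`, `exists_tower_twoSided_gt_two_mul_card`).  `6` is the Descartes ceiling here: on a
2-tower the determinant's support `{dᵢ + dⱼ}` is ordered by the `(max, min)` letter index, so for the word
`(+)^a [J] (+)^b` (`a + 1 + b = K` letters) the coefficient sequence has at most `2(b+1)` sign variations when
`J ⪯ 0` (mixed coefficients with `J` are `≤ 0`: the tower caps the side BELOW the pivot) and at most
`2(⌊a/2⌋ + b + 1)` when `J` is indefinite (`det J < 0`, mixed signs free); for `(a, b) = (1, 2)` both equal `6`, so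
`T₂₄` is Descartes-sharp.  Found by zero-forcing Levenberg–Marquardt (prescribe six roots in `log t`, solve for the
letters), integerised at scale 32; compute note `liftp3-f25-stratum` of the cell `pub-symmetroid`.
Consequence for line (B): tower-restricted letter-class laws must carry `K` (or the configuration `b`), exactly as
off towers; harmless to `TowerB` itself (polynomial counts are absorbed by `2^{C(K + log² m)}`).

[folklore] Elementary; the sign pattern is a `norm_num` certificate at rational points.
-/

-- `Summit.ValiantsHypothesis.ValiantsHypothesis.…` repeats a component by the D-0017 layout
-- (single-conjunct summit), which the `dupNamespace` linter flags; the name is mandated.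
set_option linter.dupNamespace false

namespace Summit.ValiantsHypothesis.ValiantsHypothesis.Theorems.KPlusLogSqLaw.TowerGraft

open Summit.ValiantsHypothesis.ValiantsHypothesis.Theorems.SymmetroidDescartes
  (le_card_posRoots_of_alternating)
open Summit.ValiantsHypothesis.ValiantsHypothesis.Theorems.LacunarySymmetroidMatrixDescartes (StubReverse.eval_det_pencil)
open scoped BigOperators Matrix
open Polynomial

namespace TowerTwoSidedWitness

/-- the vector `v = (43, −76)` of the rank-one PSD letter at the exponent `0` -/
def v₂₄ : Fin 2 → ℝ := ![43, -76]

/-- the vectors `u = (10, 60)`, `u' = (0, 15)` of the positive definite letter `u uᵀ + u' u'ᵀ` at the exponent `3` -/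
def u₂₄ : Fin 2 → Fin 2 → ℝ := ![![10, 60], ![0, 15]]

/-- the vector `z = (−18, −38)` of the rank-one PSD letter at the exponent `7` -/
def z₂₄ : Fin 2 → ℝ := ![-18, -38]

/-- the three PSD letters `P₀ = v vᵀ`, `P₃ = u uᵀ + u' u'ᵀ`, `P₇ = z zᵀ` (in this order) -/
def P₂₄ : Fin 3 → Matrix (Fin 2) (Fin 2) ℝ :=
  ![Matrix.vecMulVec v₂₄ v₂₄,
    Matrix.vecMulVec (u₂₄ 0) (u₂₄ 0) + Matrix.vecMulVec (u₂₄ 1) (u₂₄ 1),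
    Matrix.vecMulVec z₂₄ z₂₄]

/-- their exponents `(0, 3, 7)` -/
def d₂₄ : Fin 3 → ℕ := ![0, 3, 7]

/-- the pivot exponent `e = 1` of the indefinite letter (ONE PSD exponent below it, TWO above) -/
def e₂₄ : ℕ := 1

/-- the indefinite pivot letter `J = [[−2268, 2154], [2154, −303]]` (`det J < 0`) -/
def J₂₄ : Matrix (Fin 2) (Fin 2) ℝ := !![-2268, 2154; 2154, -303]

/-- the witness pencil `T(X) = X^1 • J + ∑ₖ X^{dₖ} • Pₖ` on the 2-tower `(0, 1, 3, 7)`, in the currency of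
`stub_twoSided` -/
noncomputable def T₂₄ : Matrix (Fin 2) (Fin 2) ℝ[X] :=
  ((X : ℝ[X]) ^ e₂₄) • J₂₄.map Polynomial.C + ∑ k, ((X : ℝ[X]) ^ d₂₄ k) • (P₂₄ k).map Polynomial.C

/-- `J` is symmetric -/
theorem J₂₄_isSymm : J₂₄.IsSymm := by
  unfold Matrix.IsSymm J₂₄
  ext i j
  fin_cases i <;> fin_cases j <;> simp

/-- `J` is indefinite: its determinant is negative (so the word is genuinely two-sided in the letter sense too) -/
theorem det_J₂₄_neg : J₂₄.det < 0 := by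
  simp [J₂₄, Matrix.det_fin_two]
  norm_num

/-- every `Pₖ` is positive semidefinite -/
theorem P₂₄_posSemidef (k : Fin 3) : (P₂₄ k).PosSemidef := by
  have h0 := Matrix.posSemidef_vecMulVec_self_star (R := ℝ) v₂₄
  have h1 := Matrix.posSemidef_vecMulVec_self_star (R := ℝ) (u₂₄ 0)
  have h1' := Matrix.posSemidef_vecMulVec_self_star (R := ℝ) (u₂₄ 1)
  have h2 := Matrix.posSemidef_vecMulVec_self_star (R := ℝ) z₂₄
  rw [star_trivial] at h0 h1 h1' h2
  fin_cases k
  · simpa [P₂₄] using h0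
  · simpa [P₂₄] using h1.add h1'
  · simpa [P₂₄] using h2

/-- the witness is two-sided: PSD exponents on both sides of the pivot -/
theorem twoSided₂₄ : (∃ k, d₂₄ k < e₂₄) ∧ (∃ k, e₂₄ < d₂₄ k) :=
  ⟨⟨0, by simp [d₂₄, e₂₄]⟩, ⟨2, by simp [d₂₄, e₂₄]⟩⟩

/-- the support `{e} ∪ {dₖ}` = `(0, 1, 3, 7)` is a genuine 2-TOWER (`2·x < y` for all exponents `x < y`; this is
`TowerGraftLine.IsTower 2` of line (B) for the sorted exponent vector), stated pairwise between the pivot and the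
PSD exponents and among the PSD exponents -/
theorem tower₂₄ : (∀ k, d₂₄ k < e₂₄ → 2 * d₂₄ k < e₂₄) ∧ (∀ k, e₂₄ < d₂₄ k → 2 * e₂₄ < d₂₄ k) ∧
    (∀ k k', d₂₄ k < d₂₄ k' → 2 * d₂₄ k < d₂₄ k') := by
  refine ⟨?_, ?_, ?_⟩
  · intro k; fin_cases k <;> simp [d₂₄, e₂₄]
  · intro k; fin_cases k <;> simp [d₂₄, e₂₄]
  · intro k k'; fin_cases k <;> fin_cases k' <;> simp [d₂₄]

/-- `det T(t)` in closed form -/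
theorem eval_det_T₂₄ (t : ℝ) :
    (T₂₄.det).eval t =
      (1849 - 2268 * t + 100 * t ^ 3 + 324 * t ^ 7) * (5776 - 303 * t + 3825 * t ^ 3 + 1444 * t ^ 7) -
        (-3268 + 2154 * t + 600 * t ^ 3 + 684 * t ^ 7) ^ 2 := by
  unfold T₂₄
  rw [StubReverse.eval_det_pencil]
  simp only [Matrix.det_fin_two, Fin.sum_univ_three, Matrix.add_apply, Matrix.smul_apply, P₂₄, v₂₄, u₂₄, z₂₄,
    J₂₄, d₂₄, e₂₄, Matrix.vecMulVec_apply, Matrix.cons_val_zero, Matrix.cons_val_one, Matrix.cons_val_two,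
    Matrix.tail_cons, Matrix.head_cons, Matrix.of_apply, Matrix.cons_val', Matrix.empty_val',
    Matrix.cons_val_fin_one, smul_eq_mul, pow_zero, pow_one, one_mul]
  ring

/-- seven positive test points -/
noncomputable def τ₂₄ : Fin 7 → ℝ := ![1/8, 1/4, 1/2, 7/8, 1, 3/2, 3]

/-- the test points increase -/
theorem τ₂₄_strictMono : StrictMono τ₂₄ := by
  refine Fin.strictMono_iff_lt_succ.2 fun j => ?_
  fin_cases j <;> simp [τ₂₄] <;> norm_num

/-- the test points are positive -/
theorem τ₂₄_pos (j : Fin 7) : 0 < τ₂₄ j := by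
  fin_cases j <;> simp [τ₂₄]

/-- `det T` alternates in sign along the test points (signs `+,−,+,−,+,−,+`; `norm_num` certificate) -/
theorem alt₂₄ (j : Fin 6) :
    (T₂₄.det).eval (τ₂₄ j.castSucc) * (T₂₄.det).eval (τ₂₄ j.succ) < 0 := by
  fin_cases j <;> simp only [eval_det_T₂₄, τ₂₄] <;> simp <;> norm_num

/-- **`Z₊ ≥ 6`** for the two-sided `2 × 2` witness on the 2-tower `(0, 1, 3, 7)`. -/
theorem six_le_card_posRoots_T₂₄ :
    6 ≤ (T₂₄.det.roots.toFinset.filter (fun t => 0 < t)).card :=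
  le_card_posRoots_of_alternating _ 6 τ₂₄ τ₂₄_strictMono τ₂₄_pos alt₂₄

end TowerTwoSidedWitness

open TowerTwoSidedWitness

/-- **The two-sided word has no `K`-free law `≤ 2m` on 2-towers either.**  It is NOT true that every two-sided
`2 × 2` pencil `X^e • J + ∑ₖ X^{dₖ} • Pₖ` (`J` symmetric, `Pₖ ⪰ 0`, four letters) whose exponent set
`{e} ∪ {dₖ}` is a 2-tower has at most `2 · 2` distinct positive zeros of its determinant: the witness `T₂₄` has at
least `6`. -/
theorem not_towerTwoSidedLaw_two : ¬ ∀ (e : ℕ) (d : Fin 3 → ℕ) (J : Matrix (Fin 2) (Fin 2) ℝ)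
    (P : Fin 3 → Matrix (Fin 2) (Fin 2) ℝ), J.IsSymm → (∀ k, (P k).PosSemidef) →
    (∀ k, d k < e → 2 * d k < e) → (∀ k, e < d k → 2 * e < d k) → (∀ k k', d k < d k' → 2 * d k < d k') →
    ((Matrix.det (((Polynomial.X : Polynomial ℝ) ^ e) • J.map Polynomial.C
        + ∑ k, ((Polynomial.X : Polynomial ℝ) ^ d k) • (P k).map Polynomial.C)).roots.toFinset.filter
          (fun t => 0 < t)).card ≤ 2 * 2 := by
  intro h
  have h6 := six_le_card_posRoots_T₂₄.trans
    (h e₂₄ d₂₄ J₂₄ P₂₄ J₂₄_isSymm P₂₄_posSemidef tower₂₄.1 tower₂₄.2.1 tower₂₄.2.2)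
  omega

/-- The same witness existentially, in the vocabulary of `stub_twoSided` plus the tower condition: a symmetric
(indeed indefinite) `J`, PSD `Pₖ` on BOTH sides of the pivot, a 2-tower support, and MORE than `2 · card ι`
positive zeros. -/
theorem exists_tower_twoSided_gt_two_mul_card :
    ∃ (e : ℕ) (d : Fin 3 → ℕ) (J : Matrix (Fin 2) (Fin 2) ℝ) (P : Fin 3 → Matrix (Fin 2) (Fin 2) ℝ),
      J.IsSymm ∧ J.det < 0 ∧ (∀ k, (P k).PosSemidef) ∧ (∃ k, d k < e) ∧ (∃ k, e < d k) ∧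
        (∀ k, d k < e → 2 * d k < e) ∧ (∀ k, e < d k → 2 * e < d k) ∧ (∀ k k', d k < d k' → 2 * d k < d k') ∧
        2 * Fintype.card (Fin 2) <
          ((Matrix.det (((X : ℝ[X]) ^ e) • J.map Polynomial.C
              + ∑ k, ((X : ℝ[X]) ^ d k) • (P k).map Polynomial.C)).roots.toFinset.filter
                (fun t => 0 < t)).card :=
  ⟨e₂₄, d₂₄, J₂₄, P₂₄, J₂₄_isSymm, det_J₂₄_neg, P₂₄_posSemidef, twoSided₂₄.1, twoSided₂₄.2, tower₂₄.1,
    tower₂₄.2.1, tower₂₄.2.2, by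
    have h6 := six_le_card_posRoots_T₂₄
    simp only [Fintype.card_fin]
    exact lt_of_lt_of_le (by norm_num) h6⟩

end Summit.ValiantsHypothesis.ValiantsHypothesis.Theorems.KPlusLogSqLaw.TowerGraft
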